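import Summits.ResolutionOfSingularities.ResolutionOfSingularities.Theorems.PurelyInseparableDim4JointForestStep
import Summits.ResolutionOfSingularities.ResolutionOfSingularities.Theorems.PurelyInseparableDim4ChartTransposition
import HarnessLib

/-!
# Purely inseparable four-folds: NORMALISED chart representatives of the points over a coordinate member (brick S3 (c)
# «joint point∘coordinate chains», part 18, cell `res-dim4-pi`)

[OURS · counted 0] (D-0157 DOOR 2; desk WORD #66 (4)(c), #74 (g), #99 (d); frame `PIDim4.TerminationImpliesOrderReduction`,
S3 (c); host item stmt-ResolutionOfSingularities-16155, helper). Nothing here proves resolution of singularities in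
dimension ≥ 4 / characteristic `p` — NOT here, not anywhere in this programme.

A rational point of the exceptional divisor of a blow-up `π : W → 𝔸⁵_K` of `V(z, x_S)` is seen in several charts; part 17's
`chartImm_transpose` moves it between them. Call a chart representative `(j, b)` (`j ∈ S`, `b_j = 0`) NORMALISED if
`b_k = 0` for every `k ∈ S` with `k < j` — i.e. `j` is the LEAST chart index at which the point is visible. This file:

* `exists_normalised_chart` — every representative `(j′, a′, b′)` has a normalised one `(j, a, b)` of the SAME point of `W`
  (take `j = min {k ∈ S : b′_k ≠ 0}` when some `k < j′` has `b′_k ≠ 0`, and transpose);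
* `rational_data_of_chartImm_eq` — the order data («on the transform», «equimultiple») of a point are read in ANY of
  its charts (orders are intrinsic: `controlledTransform_comap_chartImm` + `natCast_le_idealOrder_hypSheaf_iff`);
* **`leaf_model_point_normalised`** — part 12's `leaf_model_point` with a NORMALISED representative: every closed
  order-`p` point over the member is, on the model, `chartImm_j (a, b)` with `j ∈ S`, `b_j = 0`, `b_k = 0` (`k ∈ S`,
  `k < j`), `a^p + F′_j(b) = 0`, `(j, b)` equimultiple.

USE (next files): the joint forest's COVER condition need only be checked on normalised pairs, which lifts part 14's
per-chart restriction («a child visible in two charts»). AI-produced formalisation, weaker than expert review.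
bears_on: LADDER-RESOLUTION:D157-DOOR2 (res-dim4-pi · S3 (c) joint · normalised charts).
-/

set_option linter.dupNamespace false -- D-0017: single-problem summit path `Summit.<S>.<S>.…` by design

noncomputable section

open MvPolynomial Finset CategoryTheory AlgebraicGeometry Opposite TopologicalSpace
open AlgebraicGeometry.Scheme.IdealSheafData (ofIdealTop vanishingIdeal)

namespace Summit.ResolutionOfSingularities.ResolutionOfSingularities.Theorems.PIDim4

open Literature.AlgebraicGeometry.Resolution
open Literature.AlgebraicGeometry.Resolution.Hauser2010
open Literature.AlgebraicGeometry.Resolution.AffinePointBlowup (P A γ coord Wtop ξ)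

namespace Equimultiple

/-! ## §1 Normalised representatives -/

section Normalise

variable {K : Type} [Field K] {S : Finset (Fin 4)} {Bl : Scheme.{0}} {B : Bl ⟶ P 4 K}

/-- **EVERY RATIONAL POINT OF THE EXCEPTIONAL DIVISOR HAS A NORMALISED CHART REPRESENTATIVE**: from `(j′, a′, b′)`
(`j′ ∈ S`, `b′_{j′} = 0`) one gets `(j, a, b)` with `b_j = 0`, `b_k = 0` for all `k ∈ S` below `j`, the same off-`S`
coordinates, and `chartImm_{j′} (a′, b′) = chartImm_j (a, b)`. [cite: GortzWedhorn2020, Prop. 13.91 (3)]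
[cite: Hu2025, §5 Prop. 5.3] -/
theorem exists_normalised_chart
    (hB : IsBlowup B (AffineCoordBlowup.𝓘Λ 4 K (insert 0 (Fin.succ '' (S : Set (Fin 4))))))
    {j' : Fin 4} (hj' : j' ∈ S) (a' : K) (b' : Fin 4 → K) (hbj' : b' j' = 0) {x' : P 4 K}
    (hx' : x'.asIdeal = MvPolynomial.vanishingIdeal K {(Fin.cons a' b' : Fin (4 + 1) → K)}) :
    ∃ (j : Fin 4) (hj : j ∈ S) (a : K) (b : Fin 4 → K) (x : P 4 K),
      x.asIdeal = MvPolynomial.vanishingIdeal K {(Fin.cons a b : Fin (4 + 1) → K)} ∧ b j = 0 ∧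
        (∀ k ∈ S, k < j → b k = 0) ∧ (∀ i, i ∉ S → b i = b' i) ∧
        AffineCoordBlowup.chartImm hB (ChartDictionary.succ_mem_centreVars hj') x' =
          AffineCoordBlowup.chartImm hB (ChartDictionary.succ_mem_centreVars hj) x := by
  classical
  by_cases hN : ∀ k ∈ S, k < j' → b' k = 0
  · exact ⟨j', hj', a', b', x', hx', hbj', hN, fun i _ => rfl, rfl⟩
  · push Not at hN
    obtain ⟨k₁, hk₁, hk₁j', hbk₁⟩ := hN
    -- the least chart index with a non-zero coordinate
    set T : Finset (Fin 4) := S.filter (fun k => b' k ≠ 0) with hT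
    have hk₁T : k₁ ∈ T := Finset.mem_filter.mpr ⟨hk₁, hbk₁⟩
    have hTne : T.Nonempty := ⟨k₁, hk₁T⟩
    set j := T.min' hTne with hjdef
    have hjT : j ∈ T := Finset.min'_mem T hTne
    have hjS : j ∈ S := (Finset.mem_filter.mp hjT).1
    have hbj : b' j ≠ 0 := (Finset.mem_filter.mp hjT).2
    have hjle : j ≤ k₁ := Finset.min'_le T k₁ hk₁T
    have hjlt : j < j' := lt_of_le_of_lt hjle hk₁j'
    have hjj' : j ≠ j' := hjlt.ne
    have hmin : ∀ k ∈ S, k < j → b' k = 0 := fun k hk hkj => by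
      by_contra hbk
      exact absurd (Finset.min'_le T k (Finset.mem_filter.mpr ⟨hk, hbk⟩)) (not_le.mpr hkj)
    let b : Fin 4 → K := fun i =>
      if i = j then 0 else if i = j' then (b' j)⁻¹ else if i ∈ S then b' i * (b' j)⁻¹ else b' i
    let x : P 4 K := ⟨MvPolynomial.vanishingIdeal K {(Fin.cons (a' * (b' j)⁻¹) b : Fin (4 + 1) → K)}, inferInstance⟩
    refine ⟨j, hjS, a' * (b' j)⁻¹, b, x, rfl, by simp [b], fun k hk hkj => ?_, fun i hi => ?_,
      ChartDictionary.chartImm_transpose hB hjS hj' hjj' a' b' hbj' hbj hx' rfl⟩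
    · have hkne : k ≠ j := hkj.ne
      have hkj' : k ≠ j' := (hkj.trans hjlt).ne
      simp only [b, hkne, hkj', hk, if_false, if_true, hmin k hk hkj, zero_mul]
    · have hij : i ≠ j := fun h => hi (h ▸ hjS)
      have hij' : i ≠ j' := fun h => hi (h ▸ hj')
      simp only [b, hij, hij', hi, if_false]

end Normalise

/-! ## §2 Order data are read in any chart -/

section Transport

variable {K : Type} [Field K] {p : ℕ} [hp : Fact p.Prime] [CharP K p] {S : Finset (Fin 4)}
  {Bl : Scheme.{0}} {B : Bl ⟶ P 4 K}

/-- **The order data of a point do not depend on the chart**: if `chartImm_{j′} (a′, b′) = chartImm_j (a, b)` and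
`(a′, b′)` lies on the transform with `(j′, b′)` equimultiple, then so does `(a, b)` with `(j, b)` equimultiple
(`p ≤ ord` of the controlled transform at the common point, read on either chart).
[cite: BierstoneGrigorievMilmanWlodarczyk2011, Lemma 8.0.3 (2)] [cite: Hauser2010, §F (equiconstant points)] -/
theorem rational_data_of_chartImm_eq [DecidableEq K]
    (hB : IsBlowup B (AffineCoordBlowup.𝓘Λ 4 K (insert 0 (Fin.succ '' (S : Set (Fin 4))))))
    {j j' : Fin 4} (hj : j ∈ S) (hj' : j' ∈ S) (s : State K) (hperm : (p : ℕ∞) ≤ CentreBlowup.ordAlong S s.F)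
    {x x' : P 4 K} {a a' : K} {b b' : Fin 4 → K}
    (hx : x.asIdeal = MvPolynomial.vanishingIdeal K {(Fin.cons a b : Fin (4 + 1) → K)})
    (hx' : x'.asIdeal = MvPolynomial.vanishingIdeal K {(Fin.cons a' b' : Fin (4 + 1) → K)})
    (heqx : AffineCoordBlowup.chartImm hB (ChartDictionary.succ_mem_centreVars hj') x' =
      AffineCoordBlowup.chartImm hB (ChartDictionary.succ_mem_centreVars hj) x)
    (hab' : a' ^ p + eval b' (CentreBlowup.chartTransform p S j' s.F) = 0)
    (heq' : CentreBlowup.IsEquimultiplePoint p S j' b' s) :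
    a ^ p + eval b (CentreBlowup.chartTransform p S j s.F) = 0 ∧ CentreBlowup.IsEquimultiplePoint p S j b s := by
  have h' : (p : ℕ∞) ≤ idealOrder (hypSheaf p (CentreBlowup.chartTransform p S j' s.F)) x' :=
    (natCast_le_idealOrder_hypSheaf_iff (p := p) _ hx' p).mpr
      ((natCast_le_ordZero_translate_hyp_iff _ a' b').mpr ⟨hab', heq'⟩)
  rw [← ChartDictionary.controlledTransform_comap_chartImm p hj' s.F hperm hB, idealOrder_comap_of_isOpenImmersion,
    heqx, ← idealOrder_comap_of_isOpenImmersion (AffineCoordBlowup.chartImm hB (ChartDictionary.succ_mem_centreVars hj)),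
    ChartDictionary.controlledTransform_comap_chartImm p hj s.F hperm hB,
    natCast_le_idealOrder_hypSheaf_iff (p := p) _ hx p, natCast_le_ordZero_translate_hyp_iff] at h'
  exact h'

end Transport

/-! ## §3 The normalised model image of a point over the member -/

section ForestStep

variable {K : Type} [Field K] {p : ℕ} [hp : Fact p.Prime] [CharP K p] [DecidableEq K]
variable {Z Y W Bl : Scheme.{0}} (φ : Y ⟶ Z) [IsOpenImmersion φ] (ψ : Y ⟶ P 4 K) [IsOpenImmersion ψ]
  {π : W ⟶ Z} {B : Bl ⟶ P 4 K} {S : Finset (Fin 4)}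
  (ε : (π ⁻¹ᵁ φ.opensRange : Scheme.{0}) ≅ (B ⁻¹ᵁ ψ.opensRange : Scheme.{0}))

/-- **THE NORMALISED MODEL IMAGE OF A POINT OVER THE MEMBER**: part 12's `leaf_model_point`, with the chart
representative NORMALISED (`b_k = 0` for `k ∈ S`, `k < j`). [cite: Hauser2010, §F (equiconstant points)]
[cite: GortzWedhorn2020, Prop. 13.91] -/
theorem leaf_model_point_normalised [IsAlgClosed K] (Zc : Z.IdealSheafData)
    (hB : IsBlowup B (AffineCoordBlowup.𝓘Λ 4 K (insert 0 (Fin.succ '' (S : Set (Fin 4))))))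
    (hsq : ε.hom ≫ (B ∣_ ψ.opensRange) = (π ∣_ φ.opensRange) ≫ (φ.isoOpensRange.inv ≫ ψ.isoOpensRange.hom))
    (M : MarkedIdeal Z) (hmult : M.mult = p) (s : State K)
    (hKEY : ((controlledTransform B (AffineCoordBlowup.𝓘Λ 4 K (insert 0 (Fin.succ '' (S : Set (Fin 4)))))
        (hypSheaf p s.F) p).comap (B ⁻¹ᵁ ψ.opensRange).ι).comap ε.hom =
      (controlledTransform π Zc M.ideal p).comap (π ⁻¹ᵁ φ.opensRange).ι)
    (hperm : (p : ℕ∞) ≤ CentreBlowup.ordAlong S s.F) {w : W} (hw : IsClosed ({w} : Set W))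
    (hwx : π w ∈ φ '' (ψ ⁻¹' (AffineCoordBlowup.CΛ 4 K (insert 0 (Fin.succ '' (S : Set (Fin 4)))) : Set (P 4 K))))
    (hord : (p : ℕ∞) ≤ idealOrder (M.transform π Zc).ideal w) :
    ∃ (hwV : w ∈ π ⁻¹ᵁ φ.opensRange) (j : Fin 4) (hj : j ∈ S) (x : P 4 K) (a : K) (b : Fin 4 → K),
      AffineCoordBlowup.chartImm hB (ChartDictionary.succ_mem_centreVars hj) x =
          (B ⁻¹ᵁ ψ.opensRange).ι (ε.hom ⟨w, hwV⟩) ∧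
        x.asIdeal = MvPolynomial.vanishingIdeal K {(Fin.cons a b : Fin (4 + 1) → K)} ∧
          a ^ p + MvPolynomial.eval b (CentreBlowup.chartTransform p S j s.F) = 0 ∧ b j = 0 ∧
            (∀ k ∈ S, k < j → b k = 0) ∧ CentreBlowup.IsEquimultiplePoint p S j b s := by
  obtain ⟨hwV, j', hj', x', a', b', hxw', hx', hab', hbj', heq'⟩ :=
    leaf_model_point φ ψ ε Zc hB hsq M hmult s hKEY hperm hw hwx hord
  obtain ⟨j, hj, a, b, x, hx, hbj, hnorm, -, htr⟩ := exists_normalised_chart hB hj' a' b' hbj' hx'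
  obtain ⟨hab, heq⟩ := rational_data_of_chartImm_eq hB hj hj' s hperm hx hx' htr hab' heq'
  exact ⟨hwV, j, hj, x, a, b, htr ▸ hxw', hx, hab, hbj, hnorm, heq⟩

end ForestStep

end Equimultiple

end Summit.ResolutionOfSingularities.ResolutionOfSingularities.Theorems.PIDim4

end
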